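import Literature.AnabelianGeometry.SemiGraphs.TemperedQuasiGeometricCompatible
import Literature.AnabelianGeometry.SemiGraphs.TemperedCompactInVerticialAt
import Literature.AnabelianGeometry.SemiGraphs.TemperedEdgeLikeDistinctProofs
import Literature.AnabelianGeometry.SemiGraphs.TemperedVerticialNamedFactsProofs
import HarnessLib

/-!
# [SemiAnbd] Def. 3.8 (compatible reading) from its verticial / edge-like SHADOWS, via Thm 3.7 (iv) at the
# two graphs — the dictionary lemma of the Thm 5.4 (iii) junction (row T54-7c; proof-only)

Mochizuki, *Semi-graphs of anabelioids*, Publ. RIMS **42** (2006), §3, Def. 3.8 and Cor. 3.9, proof,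
manuscript p. 42 [cite: MochizukiSemiAnbd2006, Cor 3.9 p.42]: "… whose quasi-geometricity follows by
'substituting' the equivalences of Theorem 3.7, (iv), into Definition 3.8"; §5, Thm 5.4 (iii) p. 66: "the
proofs are entirely parallel to those of Theorem 3.7, Corollary 3.9".

PROOF-ONLY (cell abc-iut, layer L3, row T54-7c = FINDING W4d083-F2 repair, seat abc-iut-w4-d083; no
definition).  Def. 3.8 speaks of maximal compact subgroups; the arithmetic translation of §5 (and every
producer) sees only the VERTICIAL and EDGE-LIKE subgroups of a chart.  Under Thm 3.7 (iv) AT `𝒢` AND AT `ℋ`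
(`MaximalCompactIffVerticialAt`, abc-iut-w4-d075: maximal compact ⇔ verticial; nontrivial intersections of
two distinct maximal compact subgroups ⇔ nontrivial edge-like subgroups of closed edges) the three clauses of
the COMPATIBLE reading `IsCompatiblyQuasiGeometric φ` (abc-iut-L3-t2; ruling χ2) are equivalent to their
shadows on verticial / edge-like subgroups:
* `maximal` ⇐ every verticial subgroup maps onto an open subgroup of a verticial subgroup (`hV`);
* `inter`   ⇐ every nontrivial edge-like subgroup of a closed edge maps onto an open subgroup of a nontrivial
  edge-like subgroup of a closed edge (`hE`);
* `compat`  ⇐ two DISTINCT verticial subgroups meeting non-trivially go into two DISTINCT verticial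
  subgroups, respectively (`hC`) — the clause the literal Def. 3.8 lacks (the "fold", findings W4d083-F1 /
  t2g2-F1, negative knowledge O-Cor39-1).
Main result `isCompatiblyQuasiGeometric_of_shadows`; the variant `…_of_shadows'` drops the nontriviality of
the target edge-like subgroup in `hE` when `ℋ` satisfies the hypotheses of Thm 3.7 (edge-like subgroups are
infinite, abc-iut-L3-t11 `infinite_of_mem_edgeLikeSubgroups`); the converse `shadows_of_isCompatiblyQuasiGeometric`
records that nothing is lost.  This is the dictionary through which the producer's junction discharges the
compat-augmented binder `hCor39c` of `Thm54iii.clause3_of_geometric_compat`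
(`ArithQuasiGeometricSurjectiveCompat.lean`) by ONE application of the geometric Cor. 3.9 (b)
(`exists_hom_chartPullbackWith_iso_of_isCompatiblyQuasiGeometric`, abc-iut-w4-d080).  Nothing here asserts
Thm 3.7 (iv) for any graph; nothing here bears on [IUTchIII] Cor. 3.12; typed ≠ discharged.
-/

namespace Literature.AnabelianGeometry.SemiGraphs

namespace ProfiniteSemiGraph

open Topology

universe u

variable {𝒢 ℋ : ProfiniteSemiGraph.{u}}

/-- **Def. 3.8 (compatible reading) from its shadows, under Thm 3.7 (iv) at `𝒢` and at `ℋ`.**  For a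
continuous homomorphism `φ : π₁^temp(𝒢) → π₁^temp(ℋ)` of charts: if every verticial subgroup of `𝒢` maps
onto an open subgroup of a verticial subgroup of `ℋ` (`hV`), every nontrivial edge-like subgroup of a closed
edge of `𝒢` maps onto an open subgroup of a nontrivial edge-like subgroup of a closed edge of `ℋ` (`hE`), and
two distinct verticial subgroups of `𝒢` with nontrivial intersection go into two distinct verticial subgroups
of `ℋ`, respectively (`hC`), then `φ` is COMPATIBLY quasi-geometric.
[cite: MochizukiSemiAnbd2006, Cor 3.9 p.42] -/
theorem isCompatiblyQuasiGeometric_of_shadows (h37iv𝒢 : MaximalCompactIffVerticialAt 𝒢)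
    (h37ivℋ : MaximalCompactIffVerticialAt ℋ) (h𝒢 : 𝒢.Thm37Hypotheses) (hℋ : ℋ.Thm37Hypotheses)
    (c𝒢 : TemperedPiChart 𝒢) (cℋ : TemperedPiChart ℋ) (φ : c𝒢.G →ₜ* cℋ.G)
    (hV : ∀ (v : 𝒢.graph.Vertex) (K : Subgroup c𝒢.G), K ∈ verticialSubgroups c𝒢 v →
      ∃ (w : ℋ.graph.Vertex) (K₂ : Subgroup cℋ.G), K₂ ∈ verticialSubgroups cℋ w ∧
        MapsOntoOpenSubgroupOf φ.toMonoidHom K K₂)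
    (hE : ∀ (e : 𝒢.graph.Edge) (L : Subgroup c𝒢.G), 𝒢.graph.IsClosedEdge e →
      L ∈ edgeLikeSubgroups c𝒢 e → L ≠ ⊥ →
      ∃ (e' : ℋ.graph.Edge) (L₂ : Subgroup cℋ.G), ℋ.graph.IsClosedEdge e' ∧
        L₂ ∈ edgeLikeSubgroups cℋ e' ∧ L₂ ≠ ⊥ ∧ MapsOntoOpenSubgroupOf φ.toMonoidHom L L₂)
    (hC : ∀ (v₁ v₂ : 𝒢.graph.Vertex) (K₁ H₁ : Subgroup c𝒢.G), K₁ ∈ verticialSubgroups c𝒢 v₁ →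
      H₁ ∈ verticialSubgroups c𝒢 v₂ → K₁ ≠ H₁ → K₁ ⊓ H₁ ≠ ⊥ →
      ∃ (w₁ w₂ : ℋ.graph.Vertex) (K₂ H₂ : Subgroup cℋ.G), K₂ ∈ verticialSubgroups cℋ w₁ ∧
        H₂ ∈ verticialSubgroups cℋ w₂ ∧ K₂ ≠ H₂ ∧ K₁.map φ.toMonoidHom ≤ K₂ ∧ H₁.map φ.toMonoidHom ≤ H₂) :
    IsCompatiblyQuasiGeometric φ := by
  obtain ⟨hmax𝒢, hint𝒢⟩ := h37iv𝒢 h𝒢 c𝒢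
  obtain ⟨hmaxℋ, hintℋ⟩ := h37ivℋ hℋ cℋ
  refine ⟨⟨fun K₁ hK₁ => ?_, fun K₁ H₁ hK₁ hH₁ hne hnt => ?_⟩, fun K₁ H₁ hK₁ hH₁ hne hnt => ?_⟩
  · -- `maximal`: maximal compact = verticial on both sides
    obtain ⟨v, hK₁v⟩ := (hmax𝒢 K₁).mp hK₁
    obtain ⟨w, K₂, hK₂, hmaps⟩ := hV v K₁ hK₁v
    exact ⟨K₂, (hmaxℋ K₂).mpr ⟨w, hK₂⟩, hmaps⟩
  · -- `inter`: `K₁ ⊓ H₁` is a nontrivial edge-like subgroup of a closed edge; so is its target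
    obtain ⟨e, he, hL⟩ := (hint𝒢 (K₁ ⊓ H₁) hnt).mp ⟨K₁, H₁, hK₁, hH₁, hne, rfl⟩
    obtain ⟨e', L₂, he', hL₂, hL₂ne, hmaps⟩ := hE e (K₁ ⊓ H₁) he hL hnt
    obtain ⟨K₂, H₂, hK₂, hH₂, hne₂, rfl⟩ := (hintℋ L₂ hL₂ne).mpr ⟨e', he', hL₂⟩
    exact ⟨K₂, H₂, hK₂, hH₂, hne₂, hL₂ne, hmaps⟩
  · -- `compat`: the clause the literal Def. 3.8 lacks
    obtain ⟨v₁, hK₁v⟩ := (hmax𝒢 K₁).mp hK₁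
    obtain ⟨v₂, hH₁v⟩ := (hmax𝒢 H₁).mp hH₁
    obtain ⟨w₁, w₂, K₂, H₂, hK₂, hH₂, hne₂, hle₁, hle₂⟩ := hC v₁ v₂ K₁ H₁ hK₁v hH₁v hne hnt
    exact ⟨K₂, H₂, (hmaxℋ K₂).mpr ⟨w₁, hK₂⟩, (hmaxℋ H₂).mpr ⟨w₂, hH₂⟩, hne₂, hle₁, hle₂⟩

/-- **The same when `ℋ` satisfies the hypotheses of Cor. 3.9 / Thm 3.7**, without the nontriviality of the
target in `hE`: edge-like subgroups of `π₁^temp(ℋ)` are infinite (Thm 3.7 (i) + total elevation,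
abc-iut-L3-t11 `infinite_of_mem_edgeLikeSubgroups`), in particular nontrivial.
[cite: MochizukiSemiAnbd2006, Cor 3.9 p.42] -/
theorem isCompatiblyQuasiGeometric_of_shadows' (h37iv𝒢 : MaximalCompactIffVerticialAt 𝒢)
    (h37ivℋ : MaximalCompactIffVerticialAt ℋ) (h𝒢 : 𝒢.Thm37Hypotheses) (hℋ : ℋ.Thm37Hypotheses)
    (c𝒢 : TemperedPiChart 𝒢) (cℋ : TemperedPiChart ℋ) (φ : c𝒢.G →ₜ* cℋ.G)
    (hV : ∀ (v : 𝒢.graph.Vertex) (K : Subgroup c𝒢.G), K ∈ verticialSubgroups c𝒢 v →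
      ∃ (w : ℋ.graph.Vertex) (K₂ : Subgroup cℋ.G), K₂ ∈ verticialSubgroups cℋ w ∧
        MapsOntoOpenSubgroupOf φ.toMonoidHom K K₂)
    (hE : ∀ (e : 𝒢.graph.Edge) (L : Subgroup c𝒢.G), 𝒢.graph.IsClosedEdge e →
      L ∈ edgeLikeSubgroups c𝒢 e → L ≠ ⊥ →
      ∃ (e' : ℋ.graph.Edge) (L₂ : Subgroup cℋ.G), ℋ.graph.IsClosedEdge e' ∧
        L₂ ∈ edgeLikeSubgroups cℋ e' ∧ MapsOntoOpenSubgroupOf φ.toMonoidHom L L₂)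
    (hC : ∀ (v₁ v₂ : 𝒢.graph.Vertex) (K₁ H₁ : Subgroup c𝒢.G), K₁ ∈ verticialSubgroups c𝒢 v₁ →
      H₁ ∈ verticialSubgroups c𝒢 v₂ → K₁ ≠ H₁ → K₁ ⊓ H₁ ≠ ⊥ →
      ∃ (w₁ w₂ : ℋ.graph.Vertex) (K₂ H₂ : Subgroup cℋ.G), K₂ ∈ verticialSubgroups cℋ w₁ ∧
        H₂ ∈ verticialSubgroups cℋ w₂ ∧ K₂ ≠ H₂ ∧ K₁.map φ.toMonoidHom ≤ K₂ ∧ H₁.map φ.toMonoidHom ≤ H₂) :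
    IsCompatiblyQuasiGeometric φ := by
  refine isCompatiblyQuasiGeometric_of_shadows h37iv𝒢 h37ivℋ h𝒢 hℋ c𝒢 cℋ φ hV
    (fun e L he hL hnt => ?_) hC
  obtain ⟨e', L₂, he', hL₂, hmaps⟩ := hE e L he hL hnt
  haveI := infinite_of_mem_edgeLikeSubgroups verticialInjective_holds hℋ cℋ hL₂
  refine ⟨e', L₂, he', hL₂, fun h0 => ?_, hmaps⟩
  rw [h0] at hL₂
  haveI := infinite_of_mem_edgeLikeSubgroups verticialInjective_holds hℋ cℋ hL₂
  exact not_finite (⊥ : Subgroup cℋ.G)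

/-- **Converse: the shadows of a compatibly quasi-geometric homomorphism** (nothing is lost in the
dictionary): under Thm 3.7 (iv) at `𝒢` and at `ℋ`, `IsCompatiblyQuasiGeometric φ` yields `hV`, `hE`, `hC`.
[cite: MochizukiSemiAnbd2006, Cor 3.9 p.42] -/
theorem shadows_of_isCompatiblyQuasiGeometric (h37iv𝒢 : MaximalCompactIffVerticialAt 𝒢)
    (h37ivℋ : MaximalCompactIffVerticialAt ℋ) (h𝒢 : 𝒢.Thm37Hypotheses) (hℋ : ℋ.Thm37Hypotheses)
    (c𝒢 : TemperedPiChart 𝒢) (cℋ : TemperedPiChart ℋ) {φ : c𝒢.G →ₜ* cℋ.G}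
    (hφ : IsCompatiblyQuasiGeometric φ) :
    (∀ (v : 𝒢.graph.Vertex) (K : Subgroup c𝒢.G), K ∈ verticialSubgroups c𝒢 v →
      ∃ (w : ℋ.graph.Vertex) (K₂ : Subgroup cℋ.G), K₂ ∈ verticialSubgroups cℋ w ∧
        MapsOntoOpenSubgroupOf φ.toMonoidHom K K₂) ∧
    (∀ (e : 𝒢.graph.Edge) (L : Subgroup c𝒢.G), 𝒢.graph.IsClosedEdge e →
      L ∈ edgeLikeSubgroups c𝒢 e → L ≠ ⊥ →
      ∃ (e' : ℋ.graph.Edge) (L₂ : Subgroup cℋ.G), ℋ.graph.IsClosedEdge e' ∧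
        L₂ ∈ edgeLikeSubgroups cℋ e' ∧ L₂ ≠ ⊥ ∧ MapsOntoOpenSubgroupOf φ.toMonoidHom L L₂) ∧
    (∀ (v₁ v₂ : 𝒢.graph.Vertex) (K₁ H₁ : Subgroup c𝒢.G), K₁ ∈ verticialSubgroups c𝒢 v₁ →
      H₁ ∈ verticialSubgroups c𝒢 v₂ → K₁ ≠ H₁ → K₁ ⊓ H₁ ≠ ⊥ →
      ∃ (w₁ w₂ : ℋ.graph.Vertex) (K₂ H₂ : Subgroup cℋ.G), K₂ ∈ verticialSubgroups cℋ w₁ ∧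
        H₂ ∈ verticialSubgroups cℋ w₂ ∧ K₂ ≠ H₂ ∧ K₁.map φ.toMonoidHom ≤ K₂ ∧
        H₁.map φ.toMonoidHom ≤ H₂) := by
  obtain ⟨hmax𝒢, hint𝒢⟩ := h37iv𝒢 h𝒢 c𝒢
  obtain ⟨hmaxℋ, hintℋ⟩ := h37ivℋ hℋ cℋ
  refine ⟨fun v K hK => ?_, fun e L he hL hnt => ?_, fun v₁ v₂ K₁ H₁ hK₁ hH₁ hne hnt => ?_⟩
  · obtain ⟨K₂, hK₂, hmaps⟩ := hφ.isQuasiGeometric.maximal K ((hmax𝒢 K).mpr ⟨v, hK⟩)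
    obtain ⟨w, hK₂w⟩ := (hmaxℋ K₂).mp hK₂
    exact ⟨w, K₂, hK₂w, hmaps⟩
  · obtain ⟨K₁, H₁, hK₁, hH₁, hne, rfl⟩ := (hint𝒢 L hnt).mpr ⟨e, he, hL⟩
    obtain ⟨K₂, H₂, hK₂, hH₂, hne₂, hnt₂, hmaps⟩ := hφ.isQuasiGeometric.inter K₁ H₁ hK₁ hH₁ hne hnt
    obtain ⟨e', he', hL₂⟩ := (hintℋ (K₂ ⊓ H₂) hnt₂).mp ⟨K₂, H₂, hK₂, hH₂, hne₂, rfl⟩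
    exact ⟨e', K₂ ⊓ H₂, he', hL₂, hnt₂, hmaps⟩
  · obtain ⟨K₂, H₂, hK₂, hH₂, hne₂, hle₁, hle₂⟩ :=
      hφ.compat K₁ H₁ ((hmax𝒢 K₁).mpr ⟨v₁, hK₁⟩) ((hmax𝒢 H₁).mpr ⟨v₂, hH₁⟩) hne hnt
    obtain ⟨w₁, hK₂w⟩ := (hmaxℋ K₂).mp hK₂
    obtain ⟨w₂, hH₂w⟩ := (hmaxℋ H₂).mp hH₂
    exact ⟨w₁, w₂, K₂, H₂, hK₂w, hH₂w, hne₂, hle₁, hle₂⟩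

end ProfiniteSemiGraph

end Literature.AnabelianGeometry.SemiGraphs
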